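import Literature.AlgebraicGeometry.AbelianSchemes.SerreTensorProjective
import Literature.AlgebraicGeometry.AbelianSchemes.SerreTensorIdealTranslationQuasiInverse
import Literature.AlgebraicGeometry.AbelianSchemes.DualPairOfAmpleRigidified
import Literature.AlgebraicGeometry.AbelianSchemes.LDeltaRigidifiedFibrewiseAmple
import Literature.AlgebraicGeometry.AbelianSchemes.RankOneRigidifyAlongUnitSection
import Literature.AlgebraicGeometry.AbelianSchemes.KOfLKilledByInvertibleExponentOnStage
import Literature.AlgebraicGeometry.AbelianSchemes.AbelianSchemeOverQuasiInverseIsogeny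
import Literature.AlgebraicGeometry.AbelianSchemes.AbelianSchemeDualPairNormalize
import HarnessLib

/-!
# THE DUAL PAIR OF A SERRE TWIST `A ⊗_𝒪 𝔟` OF A PROJECTIVE POLARISED ABELIAN SCHEME OVER A CHARACTERISTIC-`0` BASE EXISTS
# ([MumfordAV1970] §13 Theorem (the dual via a rigidified fibrewise-ample `L`); [Conrad2004GrossZagier] §7 (Serre's tensor construction);
# [MumfordFogartyKirwan1994] Ch. 6 §2 Prop. 6.10 (`L^Δ(λ)`))

Layer `Literature/AlgebraicGeometry/AbelianSchemes`, namespace `Literature.AlgebraicGeometry.AbelianSchemes.AbelianSchemeOver`.  THEOREMS ONLY (no definition,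
no named fact, no instance, no notation, no `sorry`); universe `Scheme.{0}` (that of ★ `MumfordDual.nonempty_dualPair_of_charts_of_isProjective_of_isUnit′`).
Cell `hodgecm-mathlib` (D-0151), P6 «MOD programme», X-leaf `stub_ESHEET` («the sheet line»), organ **(M1) «DUAL PAIRS OF THE SERRE TWIST OVER `X`»**
(LA7-p01 (g3) LEGPLAN v1 §3 — «the one missing organ», `hdual` binder of ★ `exists_serreTwist_moduliTuple_of_isCMField′`; payer LA6-p02 (g2), the
`stub_DUALS` lineage).  `--supports stmt-HodgeConjecture-24832`, count-neutral; HC_CM is proved only modulo the printed citations until rung 0 closes.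

THE STATEMENT (`exists_serreTensor_dualPair_unit`).  `S` locally Noetherian over a field `F` of characteristic `0` (`f : S → Spec F`), `A∕S` a PROJECTIVE
abelian scheme with a dual pair `D` and a polarisation `λ` (`pol`), an `𝒪`-action `act` (`𝒪` any commutative ring of characteristic `0`), and a Serre
presentation `(E′, P, Q, N)` (`E′² = E′`, `E′P = P`, `QE′ = Q`, `QP = N`, `PQ = N·E′`, `N ≠ 0`) of a rank-one projective `𝔟 = E′·𝒪ᵐ`: THEN the Serre
twist `A ⊗_𝒪 𝔟` (★ `serreTensor act E′ hE′`) has a dual pair `Db` whose Poincaré bundle is trivial along `A ⊗ 𝔟 × {ε̂}` (the unit pin).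

THE ROAD (all tools ★; [MumfordAV1970] §13: «for projective `X∕S` with a rigidified relatively ample `L` the dual exists»):
(1) `A ⊗ 𝔟 → S` is projective (★ `isProjective_serreTensor_hom`: closed subgroup `Fix([E′])` of `Aᵐ`; `m ≥ 1` since `QP = N ≠ 0`);
(2) `L₀ := ψ′^* L^Δ(λ)` with `ψ′ = serreTranslateInv act E′ hE′ Q : A ⊗ 𝔟 → A` the quasi-inverse of the ideal translation `ψ_P` (`ψ_P ψ′ = [N]`, `ψ′ ψ_P = [N]`,
    ★ `serreTranslate_comp_serreTranslateInv` ∕ `serreTranslateInv_comp_serreTranslate`) and `L^Δ(λ) = Gr_λ^* 𝒫` (rank one ★ `hasRank_pullback`); `L₀` is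
    re-rigidified along the unit section WITHOUT changing its fibre classes (★ `exists_rankOne_rigidified_sameFibreClass`) to the `L` that is used;
(3) at every geometric point `s`, `[L|_{(A⊗𝔟)_s}] = (ψ′_s)^*[Θ + (−1)^*Θ]` with `Θ + (−1)^*Θ` ample on `A_s` (★ `Polarization.exists_isAmple_pullback_fst_detClass_LDelta_eq_cechClass`)
    and `ψ′_s` a FINITE SURJECTIVE isogeny (★ `isIsogeny_fibreHom_of_quasiInverse`), so the class is ample (★ `CartierDivisor.IsAmple.pullback`);
(4) on every Noetherian affine chart `Spec R ↪ S` (★ `exists_connected_affine_nbhd`; `R` an `F`-algebra, so of characteristic `0` and with every positive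
    integer invertible) ★ «KL-STAGE» `exists_nat_isUnit_pow_eq_one_of_memKOfL` gives an exponent `n ∈ R^×` killing `K(L|)`;
(5) ★ `MumfordDual.nonempty_dualPair_of_charts_of_isProjective_of_isUnit′` (the hypothesis-free road-(A) letter glued over the charts) gives a dual pair `D₀` of
    `A ⊗ 𝔟`, and ★ `DualPair.normalize` pins it along `A ⊗ 𝔟 × {ε̂}`.

## References
* [MumfordAV1970] D. Mumford, *Abelian Varieties* (1970), §13 Theorem (p. 125) and §13 (p. 123: `K(L)`), §23 (p. 231), §7 Thm. 4 (p. 72).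
* [MumfordFogartyKirwan1994] D. Mumford, J. Fogarty, F. Kirwan, *Geometric Invariant Theory*, 3rd ed. (1994), Ch. 6 §1 Cor. 6.8 (p. 118), §2 Def. 6.2–6.3 and
  Prop. 6.10 (pp. 120–121), Prop. 6.13 (iii) (p. 123).
* [Conrad2004GrossZagier] B. Conrad, *Gross–Zagier revisited*, MSRI Publ. 49 (2004), §7 (Serre's tensor construction, Thm. 7.5).
* [Hartshorne1977] R. Hartshorne, *Algebraic Geometry* (1977), II §4 (projective morphisms), III Ex. 5.7 (d) (ampleness under finite pull-back).
-/

set_option autoImplicit false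

noncomputable section

open CategoryTheory CategoryTheory.Limits AlgebraicGeometry MonoidalCategory CartesianMonoidalCategory
open scoped MonObj
open Literature.AlgebraicGeometry.Motives Literature.AlgebraicGeometry.Modules Literature.AlgebraicGeometry.AbelianVarieties
open Literature.AlgebraicGeometry.Morphisms (IsProjective exists_connected_affine_nbhd)

namespace Literature.AlgebraicGeometry.AbelianSchemes

namespace AbelianSchemeOver

/-- An affine chart of a scheme over a field of characteristic `0` containing a point has a coordinate ring of characteristic `0` in which every
positive integer is invertible. [folklore] [cite: Hartshorne1977, II §2 (Spec as a functor, Prop. 2.3)] -/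
private theorem charZero_and_isUnit_of_chart {S : Scheme.{0}} {F : Type} [Field F] [CharZero F] (f : S ⟶ Spec (.of F))
    {R : Type} [CommRing R] (c : Spec (.of R) ⟶ S) (x : ↥(Spec (.of R))) :
    CharZero R ∧ ∀ d : ℕ, 0 < d → IsUnit ((d : ℕ) : R) := by
  let φ : F →+* R := (Spec.preimage (c ≫ f)).hom
  haveI : Nontrivial R := by
    rcases subsingleton_or_nontrivial R with h | h
    · exact absurd (Subsingleton.elim x.asIdeal ⊤) x.2.ne_top
    · exact h
  refine ⟨(RingHom.charZero_iff φ.injective).mp inferInstance, fun d hd => ?_⟩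
  have h := (IsUnit.mk0 ((d : ℕ) : F) (Nat.cast_ne_zero.2 hd.ne')).map φ
  rwa [map_natCast] at h

/-- **THE DUAL PAIR OF THE SERRE TWIST `A ⊗_𝒪 𝔟` EXISTS, WITH UNIT PIN** (organ (M1) of the sheet line; the presentation-indexed `hdual` binder of ★
`exists_serreTwist_moduliTuple_of_isCMField′`).  `S` locally Noetherian over a characteristic-`0` field, `A∕S` projective with dual pair `D` and polarisation
`pol`, `act` an `𝒪`-action (`𝒪` of characteristic `0`), `(E′, P, Q, N)` a Serre presentation with `N ≠ 0`: there is `Db : (A ⊗_𝒪 𝔟).DualPair` with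
`(1 × ε̂)^* 𝒫_{Db}` trivial.  Road (1)–(5) of the module docstring: [MumfordAV1970] §13 Theorem for the projective `A ⊗ 𝔟` and the rigidified fibrewise-ample
`ψ′^* L^Δ(λ)`, `K` of which is killed by an invertible exponent chart by chart (characteristic `0`); normalisation ★ `DualPair.normalize`.
[cite: MumfordAV1970, §13 Theorem (p. 125) and §13 (p. 123)] [cite: MumfordFogartyKirwan1994, Ch. 6 §1 Cor. 6.8 (p. 118), §2 Prop. 6.10 (p. 121) and Prop. 6.13 (iii) (p. 123)]
[cite: Conrad2004GrossZagier, §7 (Thm. 7.5)] [cite: Hartshorne1977, III Ex. 5.7 (d)] -/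
theorem exists_serreTensor_dualPair_unit {S : Scheme.{0}} [IsLocallyNoetherian S]
    {F : Type} [Field F] [CharZero F] (f : S ⟶ Spec (.of F))
    (A : AbelianSchemeOver S) [IsCommMonObj A.X] (hproj : IsProjective A.X.hom)
    (D : A.DualPair) (pol : A.Polarization D)
    {O : Type} [CommRing O] [CharZero O] (act : A.RingAction O)
    {m : ℕ} (E' : Matrix (Fin m) (Fin m) O) (hE' : E' * E' = E') (P : Matrix (Fin m) (Fin 1) O) (Q : Matrix (Fin 1) (Fin m) O)
    {N : ℕ} (hN : N ≠ 0) (hP : E' * P = P) (hQ : Q * E' = Q) (hQP : Q * P = Matrix.scalar (Fin 1) (N : O))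
    (hPQ : P * Q = Matrix.scalar (Fin m) (N : O) * E') :
    ∃ Db : (serreTensor act E' hE').DualPair,
      Nonempty ((Scheme.Modules.pullback (DualPair.unitHatSlice Db)).obj Db.P ≅ SheafOfModules.unit _) := by
  classical
  -- (0) `m ≠ 0`: for `m = 0`, `QP = 0 = N·1` forces `N = 0`
  have hm : m ≠ 0 := by
    rintro rfl
    have h00 := congrFun (congrFun hQP 0) 0
    rw [Matrix.mul_apply, Finset.univ_eq_empty, Finset.sum_empty, Matrix.scalar_apply, Matrix.diagonal_apply_eq] at h00
    exact hN (Nat.cast_eq_zero.1 h00.symm)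
  -- the twist `B = A ⊗ 𝔟`, projective over `S` (★ piece 1)
  set B : AbelianSchemeOver S := serreTensor act E' hE' with hBdef
  have hprojB : IsProjective B.X.hom := isProjective_serreTensor_hom act hproj hm E' hE'
  -- the quasi-inverse `ψ′` of the ideal translation `ψ_P`
  haveI : IsMonHom (serreTranslateInv act E' hE' Q) := isMonHom_serreTranslateInv act E' hE' Q
  haveI : IsMonHom (serreTranslate act E' hE' P) := isMonHom_serreTranslate act E' hE' P
  have h1 : serreTranslate act E' hE' P ≫ serreTranslateInv act E' hE' Q = (𝟙 A.X) ^ N :=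
    serreTranslate_comp_serreTranslateInv act E' hE' P Q hP hQ hQP
  have h2 : serreTranslateInv act E' hE' Q ≫ serreTranslate act E' hE' P = (𝟙 B.X) ^ N :=
    serreTranslateInv_comp_serreTranslate act E' hE' P Q hP hQ hPQ
  -- (2) the graph of `λ` and `L^Δ(λ) = Gr^*𝒫`
  let Gr : A.X.left ⟶ A.prodLeft D.hat :=
    pullback.lift (𝟙 _) pol.lam.left (by rw [Category.id_comp]; exact (Over.w pol.lam).symm)
  have hGr₁ : Gr ≫ pullback.fst A.X.hom D.hat.X.hom = 𝟙 _ := pullback.lift_fst _ _ _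
  have hGr₂ : Gr ≫ pullback.snd A.X.hom D.hat.X.hom = pol.lam.left := pullback.lift_snd _ _ _
  have hLΔ : HasRank ((Scheme.Modules.pullback Gr).obj D.P) 1 := hasRank_pullback Gr D.hasRank_one
  -- `L₀ := ψ′^* L^Δ(λ)` on `B`, re-rigidified to `L` with the same fibre classes
  have hL₀ : HasRank ((Scheme.Modules.pullback (serreTranslateInv act E' hE' Q).left).obj ((Scheme.Modules.pullback Gr).obj D.P)) 1 :=
    hasRank_pullback _ hLΔ
  obtain ⟨L, hL, hε, hsame⟩ := B.exists_rankOne_rigidified_sameFibreClass _ hL₀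
  -- (3) the fibre classes of `L` are ample: `(ψ′_s)^*[Θ + (−1)^*Θ]`
  have hΘ : ∀ ⦃Ω : Type⦄ [Field Ω] [IsAlgClosed Ω] (s : Spec (.of Ω) ⟶ S),
      ∃ Θ : CartierDivisor (B.fibre s).toAbelianVariety.X.left, Θ.IsAmple ∧
        CechPic.pullback (X := (B.fibre s).toAbelianVariety.X.left) (pullback.fst B.X.hom s)
          (detClass (HasRank.isFiniteLocallyFree' hL)) = Θ.cechClass := by
    intro Ω _ _ s
    obtain ⟨ΘA, hΘA, hcl⟩ := pol.exists_isAmple_pullback_fst_detClass_LDelta_eq_cechClass A Gr hGr₁ hGr₂ (HasRank.isFiniteLocallyFree' hLΔ) s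
    have hiso := isIsogeny_fibreHom_of_quasiInverse (serreTranslateInv act E' hE' Q) (serreTranslate act E' hE' P) hN h2 h1 s
    haveI : Surjective (AbelianVariety.Hom.toSchemeHom (fibreHom (serreTranslateInv act E' hE' Q) s)) := hiso.1
    haveI : IsFinite (AbelianVariety.Hom.toSchemeHom (fibreHom (serreTranslateInv act E' hE' Q) s)) := hiso.2
    haveI : IsDominant (AbelianVariety.Hom.toSchemeHom (fibreHom (serreTranslateInv act E' hE' Q) s)) := ⟨hiso.1.1.denseRange⟩
    refine ⟨ΘA.pullback (AbelianVariety.Hom.toSchemeHom (fibreHom (serreTranslateInv act E' hE' Q) s)), hΘA.pullback _, (hsame s).trans ?_⟩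
    rw [CartierDivisor.cechClass_pullback, ← hcl, detClass_pullback _ (HasRank.isFiniteLocallyFree' hLΔ), ← CechPic.pullback_comp,
      ← CechPic.pullback_comp, fibreHom_toSchemeHom_fst]
    rfl
  -- (4) Noetherian affine charts of characteristic `0`
  choose Rs instRs ch hch using fun s : ↥S => exists_connected_affine_nbhd (S := S) s
  haveI hopen : ∀ s, IsOpenImmersion (ch s) := fun s => (hch s).1
  haveI hnoeth : ∀ s, IsNoetherianRing (Rs s) := fun s => by
    haveI : IsLocallyNoetherian (Spec (.of (Rs s))) := isLocallyNoetherian_of_isOpenImmersion (ch s)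
    exact (isLocallyNoetherian_Spec (R := .of (Rs s))).mp inferInstance
  have hcov : ∀ s : ↥S, ∃ j, s ∈ Set.range (ch j) := fun s => ⟨s, (hch s).2.1⟩
  -- chart data
  have hbc : ∀ s, (B.baseChange (ch s)).IsBaseChangeVia B (ch s) (pullback.fst B.X.hom (ch s)) := fun s => B.baseChange_isBaseChangeVia (ch s)
  have hL' : ∀ s, HasRank ((Scheme.Modules.pullback (pullback.fst B.X.hom (ch s))).obj L) 1 :=
    fun s => hasRank_pullback (pullback.fst B.X.hom (ch s)) hL
  have hε' : ∀ s, CechPic.pullback (B.baseChange (ch s)).unitSection (detClass (HasRank.isFiniteLocallyFree' (hL' s))) = 1 :=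
    fun s => B.pullback_unitSection_detClass_baseChange_eq_one (ch s) hL hε
  have hΘ' : ∀ s ⦃Ω : Type⦄ [Field Ω] [IsAlgClosed Ω] (s' : Spec (.of Ω) ⟶ Spec (.of (Rs s))),
      ∃ Θ' : CartierDivisor (((B.baseChange (ch s)).fibre s').toAbelianVariety.X.left), Θ'.IsAmple ∧
        CechPic.pullback (X := ((B.baseChange (ch s)).fibre s').toAbelianVariety.X.left) (pullback.fst (B.baseChange (ch s)).X.hom s')
          (detClass (HasRank.isFiniteLocallyFree' (hL' s))) = Θ'.cechClass :=
    fun s Ω _ _ s' => B.exists_isAmple_cechClass_fibre_baseChange hL hΘ (ch s) (hL' s) s'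
  have hproj' : ∀ s, IsProjective (B.baseChange (ch s)).X.hom := fun s => by
    rw [AbelianSchemeOver.baseChange_hom]
    exact hprojB.pullback_snd (ch s)
  -- the exponent killing `K(L|)` on each chart (★ KL-STAGE at the identity stage)
  have hkill₀ : ∀ s, ∃ n : ℕ, IsUnit ((n : ℕ) : Rs s) ∧ ∀ (T : Over (Spec (.of (Rs s)))) (u : T ⟶ (B.baseChange (ch s)).X),
      (B.baseChange (ch s)).MemKOfL ((Scheme.Modules.pullback (pullback.fst B.X.hom (ch s))).obj L) u → u ^ n = 1 := by
    intro s
    obtain ⟨x, hx⟩ := (hch s).2.1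
    obtain ⟨hchar, hunit⟩ := charZero_and_isUnit_of_chart f (ch s) x
    haveI := hchar
    obtain ⟨d, hd, n, -, -, hstage⟩ := (B.baseChange (ch s)).exists_nat_isUnit_pow_eq_one_of_memKOfL (hL' s) (hε' s) (hΘ' s)
    have hid : Spec.map (CommRingCat.ofHom (RingHom.id (Rs s))) = 𝟙 (Spec (.of (Rs s))) := by
      rw [CommRingCat.ofHom_id, Spec.map_id]
    have hrefl : (B.baseChange (ch s)).IsBaseChangeVia (B.baseChange (ch s)) (Spec.map (CommRingCat.ofHom (RingHom.id (Rs s)))) (𝟙 _) := by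
      rw [hid]
      exact IsBaseChangeVia.refl _
    obtain ⟨hn, hk⟩ := hstage (Rs s) (RingHom.id (Rs s)) (hunit d hd) (B.baseChange (ch s)) (𝟙 _) hrefl
    refine ⟨n, hn, fun T u hu => hk T u ?_⟩
    exact ((B.baseChange (ch s)).memKOfL_iff_of_iso ((Scheme.Modules.pullbackId _).app _) (hasRank_pullback _ (hL' s)) (hL' s) u).2 hu
  choose nn hnn hkill using hkill₀
  -- (5) the glued road-(A) letter, then normalisation
  obtain ⟨D₀⟩ := MumfordDual.nonempty_dualPair_of_charts_of_isProjective_of_isUnit' B Rs ch hcov hproj'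
    (fun s => (Scheme.Modules.pullback (pullback.fst B.X.hom (ch s))).obj L) hL' hε' hΘ' nn hnn hkill
  exact ⟨D₀.normalize, D₀.nonempty_unitHatSlice_iso_normalize⟩

end AbelianSchemeOver

end Literature.AlgebraicGeometry.AbelianSchemes

end
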